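import Mathlib
import Summits.Ventures.PercRepro2.Defs
import Summits.Ventures.PercRepro2.Independence
import Summits.Ventures.PercRepro2.Harris
import Summits.Ventures.PercRepro2.ObsIndependence
import Summits.Ventures.PercRepro2.CoinDefs
import Summits.Ventures.PercRepro2.CoinArcsOff
import Summits.Ventures.PercRepro2.CoinPendantDefs
import Summits.Ventures.PercRepro2.CoinPendant
import Summits.Ventures.PercRepro2.CoinChain
import Summits.Ventures.PercRepro2.CoinPathDefs
import Summits.Ventures.PercRepro2.CoinPathAlg

/-!
# The pendant path `w → v → t` with arbitrary entries: row 2′DARC by the CHAIN lemma (blind cell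
PercRepro2, night-2; proofs/NIGHT2-DARC.md §12)

The three levels of `CoinPathDefs.lean` give `R_T = (L₀ ∩ R₀) ∪ (L₁ ∩ R₁) ∪ (L₂ ∩ R₂)` and
`gate = (L₀ ∩ R₀) ∪ (L₁ ∩ R₁) ∪ (L₂ ∩ R₃)` with the reduced avoidance events
`R₀ = R^{D₀}_T ⊇ R₁ = R^{D₀}_{T∪{v}} ⊇ R₂ = R^{D₀}_{T∪{v,w}} ⊇ R₃ = R^{D₀}_{T∪{u,v,w}}`; the level events
depend on the two path coins only, the reduced events on the other coins, so every mass factorises.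
The branch means decrease along the chain (Lemma-A shifts in `D₀`, hypotheses in cleared form,
together with the three branch covariances) and the three-branch algebra `path_alg` (the chain
lemma: Chebyshev on the non-pivotal branches absorbs the pivotal branch's weight deficit) gives
`DARC` (`darc_of_path`, CONDITIONAL on directed BHK for mixed coin systems).  This is the first case
beyond the sink theorem where the middle branch's shift product can be negative.
-/

namespace Summit.Ventures.PercRepro2.Coin

section PathTheorem

open Classical

variable {V : Type*} {E : Type*} [DecidableEq V] [Fintype E] [DecidableEq E]
  {R : Type*} [Field R] [LinearOrder R] [IsStrictOrderedRing R]

/-- **THEOREM (the pendant path `w → v → t`, arbitrary entries into `v`), conditional on directed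
BHK for the reduced mixed system.** Path coins `c₁ = {w → v}`, `c₂ = {v → t}` (`t ∈ T`), the only
coins leaving `w` or `v`; `a, b ∉ {w, v} ∪ T`; `D₀ = arcsOff arcs ({w, v} ∪ T)` with the chain
`R₀ ⊇ R₁ ⊇ R₂ ⊇ R₃` as above. Hypotheses (cleared forms): positivity of the four reduced events,
covariances `≥ 0` on the gate pieces `R₀, R₁, R₃`, and the Lemma-A shift orderings
`E[·|R₀] ≥ E[·|R₁] ≥ E[·|R₂] ≥ E[·|R₃]` for both markers. Conclusion: `DARC p arcs s T a b u w`. -/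
theorem darc_of_path (p : E → R) (hp : IsProbVec p) (arcs : E → Finset (V × V)) (s : V)
    (T : Finset V) (a b u w v t : V) (c₁ c₂ : E)
    (hc₁ : arcs c₁ = {(w, v)}) (hc₂ : arcs c₂ = {(v, t)}) (hne : c₁ ≠ c₂) (hwv : w ≠ v)
    (htT : t ∈ T) (hwT : w ∉ T) (hvT : v ∉ T) (hpath : OnlyPathCoins arcs w v c₁ c₂)
    (ha : a ∉ ({w, v} : Finset V) ∪ T) (hb : b ∉ ({w, v} : Finset V) ∪ T)
    (hL₂pos : 0 < prob p (openEdge c₂ ∩ openEdge c₁))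
    (hP₀ : 0 < prob p (avoidEvent (arcsOff arcs ({w, v} ∪ T)) s T))
    (hP₁ : 0 < prob p (avoidEvent (arcsOff arcs ({w, v} ∪ T)) s (insert v T)))
    (hP₂ : 0 < prob p (avoidEvent (arcsOff arcs ({w, v} ∪ T)) s (insert w (insert v T))))
    (hP₃ : 0 < prob p (avoidEvent (arcsOff arcs ({w, v} ∪ T)) s
      (insert u (insert w (insert v T)))))
    (hcov₀ : 0 ≤ covC p (arcsOff arcs ({w, v} ∪ T)) s a b
      (avoidEvent (arcsOff arcs ({w, v} ∪ T)) s T))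
    (hcov₁ : 0 ≤ covC p (arcsOff arcs ({w, v} ∪ T)) s a b
      (avoidEvent (arcsOff arcs ({w, v} ∪ T)) s (insert v T)))
    (hcov₃ : 0 ≤ covC p (arcsOff arcs ({w, v} ∪ T)) s a b
      (avoidEvent (arcsOff arcs ({w, v} ∪ T)) s (insert u (insert w (insert v T)))))
    (hA₀₁ : massE p (marker (R := R) (arcsOff arcs ({w, v} ∪ T)) s a)
        (avoidEvent (arcsOff arcs ({w, v} ∪ T)) s (insert v T))
        * prob p (avoidEvent (arcsOff arcs ({w, v} ∪ T)) s T) ≤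
      massE p (marker (R := R) (arcsOff arcs ({w, v} ∪ T)) s a)
        (avoidEvent (arcsOff arcs ({w, v} ∪ T)) s T)
        * prob p (avoidEvent (arcsOff arcs ({w, v} ∪ T)) s (insert v T)))
    (hA₁₂ : massE p (marker (R := R) (arcsOff arcs ({w, v} ∪ T)) s a)
        (avoidEvent (arcsOff arcs ({w, v} ∪ T)) s (insert w (insert v T)))
        * prob p (avoidEvent (arcsOff arcs ({w, v} ∪ T)) s (insert v T)) ≤
      massE p (marker (R := R) (arcsOff arcs ({w, v} ∪ T)) s a)
        (avoidEvent (arcsOff arcs ({w, v} ∪ T)) s (insert v T))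
        * prob p (avoidEvent (arcsOff arcs ({w, v} ∪ T)) s (insert w (insert v T))))
    (hA₂₃ : massE p (marker (R := R) (arcsOff arcs ({w, v} ∪ T)) s a)
        (avoidEvent (arcsOff arcs ({w, v} ∪ T)) s (insert u (insert w (insert v T))))
        * prob p (avoidEvent (arcsOff arcs ({w, v} ∪ T)) s (insert w (insert v T))) ≤
      massE p (marker (R := R) (arcsOff arcs ({w, v} ∪ T)) s a)
        (avoidEvent (arcsOff arcs ({w, v} ∪ T)) s (insert w (insert v T)))
        * prob p (avoidEvent (arcsOff arcs ({w, v} ∪ T)) s (insert u (insert w (insert v T)))))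
    (hB₀₁ : massE p (marker (R := R) (arcsOff arcs ({w, v} ∪ T)) s b)
        (avoidEvent (arcsOff arcs ({w, v} ∪ T)) s (insert v T))
        * prob p (avoidEvent (arcsOff arcs ({w, v} ∪ T)) s T) ≤
      massE p (marker (R := R) (arcsOff arcs ({w, v} ∪ T)) s b)
        (avoidEvent (arcsOff arcs ({w, v} ∪ T)) s T)
        * prob p (avoidEvent (arcsOff arcs ({w, v} ∪ T)) s (insert v T)))
    (hB₁₂ : massE p (marker (R := R) (arcsOff arcs ({w, v} ∪ T)) s b)
        (avoidEvent (arcsOff arcs ({w, v} ∪ T)) s (insert w (insert v T)))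
        * prob p (avoidEvent (arcsOff arcs ({w, v} ∪ T)) s (insert v T)) ≤
      massE p (marker (R := R) (arcsOff arcs ({w, v} ∪ T)) s b)
        (avoidEvent (arcsOff arcs ({w, v} ∪ T)) s (insert v T))
        * prob p (avoidEvent (arcsOff arcs ({w, v} ∪ T)) s (insert w (insert v T))))
    (hB₂₃ : massE p (marker (R := R) (arcsOff arcs ({w, v} ∪ T)) s b)
        (avoidEvent (arcsOff arcs ({w, v} ∪ T)) s (insert u (insert w (insert v T))))
        * prob p (avoidEvent (arcsOff arcs ({w, v} ∪ T)) s (insert w (insert v T))) ≤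
      massE p (marker (R := R) (arcsOff arcs ({w, v} ∪ T)) s b)
        (avoidEvent (arcsOff arcs ({w, v} ∪ T)) s (insert w (insert v T)))
        * prob p (avoidEvent (arcsOff arcs ({w, v} ∪ T)) s (insert u (insert w (insert v T))))) :
    DARC p arcs s T a b u w := by
  -- notation
  set Z : Finset V := {w, v} ∪ T with hZ
  set D₀ := arcsOff arcs Z with hD₀
  set F : Set E := {c₁, c₂} with hF
  set L₀ : Set (Config E) := closedEdge c₂ with hL₀
  set L₁ : Set (Config E) := openEdge c₂ ∩ closedEdge c₁ with hL₁
  set L₂ : Set (Config E) := openEdge c₂ ∩ openEdge c₁ with hL₂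
  set X := marker (R := R) arcs s a with hX
  set Y := marker (R := R) arcs s b with hY
  set X₀ := marker (R := R) D₀ s a with hX₀
  set Y₀ := marker (R := R) D₀ s b with hY₀
  set R₀ := avoidEvent D₀ s T with hR₀
  set R₁ := avoidEvent D₀ s (insert v T) with hR₁
  set R₂ := avoidEvent D₀ s (insert w (insert v T)) with hR₂
  set R₃ := avoidEvent D₀ s (insert u (insert w (insert v T))) with hR₃
  have bool_contra : ∀ {x : Bool}, x = false → x = true → False := fun h1 h2 => by
    rw [h1] at h2; exact absurd h2 (by decide)
  -- the level decompositions
  have hbw : ∀ ω : Config E, ω ∈ bwdEvent arcs w T ↔ (ω c₁ = true ∧ ω c₂ = true) :=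
    bwd_w_iff hc₁ hc₂ hwv htT hwT hvT hpath
  have hRT : avoidEvent arcs s T = (L₀ ∩ R₀ ∪ L₁ ∩ R₁) ∪ L₂ ∩ R₂ := by
    ext ω
    simp only [Set.mem_union, Set.mem_inter_iff, hL₀, hL₁, hL₂, openEdge, closedEdge,
      Set.mem_setOf_eq]
    cases h₂ : ω c₂ <;> cases h₁ : ω c₁
    · have e : ω ∈ avoidEvent arcs s T ↔ ω ∈ R₀ :=
        avoid_level₀ hc₁ hc₂ hwv htT hwT hvT hpath (s := s) h₂
      simp [e]
    · have e : ω ∈ avoidEvent arcs s T ↔ ω ∈ R₀ :=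
        avoid_level₀ hc₁ hc₂ hwv htT hwT hvT hpath (s := s) h₂
      simp [e]
    · have e : ω ∈ avoidEvent arcs s T ↔ ω ∈ R₁ :=
        avoid_level₁ hc₁ hc₂ hwv htT hwT hvT hpath (s := s) h₁ h₂
      simp [e]
    · have e : ω ∈ avoidEvent arcs s T ↔ ω ∈ R₂ :=
        avoid_level₂ hc₁ hc₂ hwv htT hwT hvT hpath (s := s) h₁ h₂
      simp [e]
  have hGate : gateEvent arcs s T u w = (L₀ ∩ R₀ ∪ L₁ ∩ R₁) ∪ L₂ ∩ R₃ := by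
    ext ω
    simp only [Set.mem_union, Set.mem_inter_iff, hL₀, hL₁, hL₂, openEdge, closedEdge,
      Set.mem_setOf_eq]
    cases h₂ : ω c₂ <;> cases h₁ : ω c₁
    · have hG : ω ∉ bwdEvent arcs w T := fun hh => bool_contra h₂ ((hbw ω).mp hh).2
      have e : ω ∈ gateEvent arcs s T u w ↔ ω ∈ R₀ :=
        (gate_eq_avoid_of_not_bwd hG).trans (avoid_level₀ hc₁ hc₂ hwv htT hwT hvT hpath (s := s) h₂)
      simp [e]
    · have hG : ω ∉ bwdEvent arcs w T := fun hh => bool_contra h₂ ((hbw ω).mp hh).2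
      have e : ω ∈ gateEvent arcs s T u w ↔ ω ∈ R₀ :=
        (gate_eq_avoid_of_not_bwd hG).trans (avoid_level₀ hc₁ hc₂ hwv htT hwT hvT hpath (s := s) h₂)
      simp [e]
    · have hG : ω ∉ bwdEvent arcs w T := fun hh => bool_contra h₁ ((hbw ω).mp hh).1
      have e : ω ∈ gateEvent arcs s T u w ↔ ω ∈ R₁ :=
        (gate_eq_avoid_of_not_bwd hG).trans
          (avoid_level₁ hc₁ hc₂ hwv htT hwT hvT hpath (s := s) h₁ h₂)
      simp [e]
    · have e : ω ∈ gateEvent arcs s T u w ↔ ω ∈ R₃ :=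
        gate_level₂ hc₁ hc₂ hwv htT hwT hvT hpath (s := s) (u := u) h₁ h₂
      simp [e]
  -- disjointness
  have mem₀ : ∀ {ω : Config E}, ω ∈ L₀ → ω c₂ = false := fun h => h
  have mem₁ : ∀ {ω : Config E}, ω ∈ L₁ → ω c₂ = true ∧ ω c₁ = false := fun h => h
  have mem₂ : ∀ {ω : Config E}, ω ∈ L₂ → ω c₂ = true ∧ ω c₁ = true := fun h => h
  have hd₀₁ : Disjoint (L₀ ∩ R₀) (L₁ ∩ R₁) :=
    Set.disjoint_left.2 fun ω h₁ h₂ => bool_contra (mem₀ h₁.1) (mem₁ h₂.1).1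
  have hd₂ : Disjoint (L₀ ∩ R₀ ∪ L₁ ∩ R₁) (L₂ ∩ R₂) := Set.disjoint_left.2 fun ω h₁ h₂ => by
    rcases (Set.mem_union _ _ _).mp h₁ with h₁ | h₁
    · exact bool_contra (mem₀ h₁.1) (mem₂ h₂.1).1
    · exact bool_contra (mem₁ h₁.1).2 (mem₂ h₂.1).2
  have hd₃ : Disjoint (L₀ ∩ R₀ ∪ L₁ ∩ R₁) (L₂ ∩ R₃) := Set.disjoint_left.2 fun ω h₁ h₂ => by
    rcases (Set.mem_union _ _ _).mp h₁ with h₁ | h₁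
    · exact bool_contra (mem₀ h₁.1) (mem₂ h₂.1).1
    · exact bool_contra (mem₁ h₁.1).2 (mem₂ h₂.1).2
  -- dependence structure
  have hc₁F : ({c₁} : Set E) ⊆ F := by simp [hF]
  have hc₂F : ({c₂} : Set E) ⊆ F := by simp [hF]
  have hL₀F : DependsOn (· ∈ L₀) F := (dependsOn_closedEdge c₂).mono hc₂F
  have hL₁F : DependsOn (· ∈ L₁) F :=
    (dependsOn_inter (dependsOn_openEdge c₂) (dependsOn_closedEdge c₁)).mono
      (Set.union_subset hc₂F hc₁F)
  have hL₂F : DependsOn (· ∈ L₂) F :=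
    (dependsOn_inter (dependsOn_openEdge c₂) (dependsOn_openEdge c₁)).mono
      (Set.union_subset hc₂F hc₁F)
  have hempty : ∀ e ∈ F, D₀ e = ∅ := by
    intro e he
    simp only [hF, Set.mem_insert_iff, Set.mem_singleton_iff] at he
    rcases he with rfl | rfl
    · rw [hD₀]; ext xy; simp [arcsOff, hc₁, hZ, Finset.filter_singleton]
    · rw [hD₀]; ext xy; simp [arcsOff, hc₂, hZ, Finset.filter_singleton]
  have hcongr : ∀ ω ω' : Config E, (∀ e ∈ Fᶜ, ω e = ω' e) → ∀ e, D₀ e ≠ ∅ → ω e = ω' e := by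
    intro ω ω' h e he
    by_cases hmem : e ∈ F
    · exact absurd (hempty e hmem) he
    · exact h e hmem
  have hdep : ∀ (X' : Finset V) (f : Config E → R), DependsOn f Fᶜ →
      DependsOn ((avoidEvent D₀ s X').indicator f) Fᶜ := by
    intro X' f hf ω ω' h
    have hreach : ∀ x y, Reach D₀ ω x y ↔ Reach D₀ ω' x y :=
      fun x y => reach_arcsOff_congr (hcongr ω ω' h)
    have hmem : ω ∈ avoidEvent D₀ s X' ↔ ω' ∈ avoidEvent D₀ s X' := by
      simp only [avoidEvent, Set.mem_setOf_eq, hreach]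
    by_cases hω : ω ∈ avoidEvent D₀ s X'
    · rw [Set.indicator_of_mem hω, Set.indicator_of_mem (hmem.mp hω)]; exact hf h
    · rw [Set.indicator_of_notMem hω, Set.indicator_of_notMem (fun h' => hω (hmem.mpr h'))]
  have hdepX : DependsOn X₀ Fᶜ := by
    intro ω ω' h
    have hr : Reach D₀ ω s a ↔ Reach D₀ ω' s a := reach_arcsOff_congr (hcongr ω ω' h)
    simp only [hX₀, marker, hr]
  have hdepY : DependsOn Y₀ Fᶜ := by
    intro ω ω' h
    have hr : Reach D₀ ω s b ↔ Reach D₀ ω' s b := reach_arcsOff_congr (hcongr ω ω' h)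
    simp only [hY₀, marker, hr]
  have hdepXY : DependsOn (fun ω => X₀ ω * Y₀ ω) Fᶜ := fun ω ω' h => by
    show X₀ ω * Y₀ ω = X₀ ω' * Y₀ ω'
    rw [hdepX h, hdepY h]
  have hdep1 : DependsOn (fun _ : Config E => (1 : R)) Fᶜ := fun _ _ _ => rfl
  have hfac : ∀ (B₀ : Set (Config E)) (hB₀ : DependsOn (· ∈ B₀) F) (X' : Finset V)
      (f : Config E → R) (hf : DependsOn f Fᶜ),
      massE p f (B₀ ∩ avoidEvent D₀ s X') = prob p B₀ * massE p f (avoidEvent D₀ s X') :=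
    fun B₀ hB₀ X' f hf => massE_inter_of_dependsOn' p F B₀ hB₀ f _ (hdep X' f hf)
  -- the markers agree with the reduced markers on every piece (all pieces lie in `R_T`)
  have hmX : ∀ ω ∈ avoidEvent arcs s T, X ω = X₀ ω := by
    intro ω hω
    have hr : Reach arcs ω s a ↔ Reach D₀ ω s a := reach_iff_path hc₁ hc₂ htT hpath hω ha
    simp only [hX, hX₀, marker, hr]
  have hmY : ∀ ω ∈ avoidEvent arcs s T, Y ω = Y₀ ω := by
    intro ω hω
    have hr : Reach arcs ω s b ↔ Reach D₀ ω s b := reach_iff_path hc₁ hc₂ htT hpath hω hb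
    simp only [hY, hY₀, marker, hr]
  have hsub₀ : L₀ ∩ R₀ ⊆ avoidEvent arcs s T := by rw [hRT]; intro ω h; exact Or.inl (Or.inl h)
  have hsub₁ : L₁ ∩ R₁ ⊆ avoidEvent arcs s T := by rw [hRT]; intro ω h; exact Or.inl (Or.inr h)
  have hsub₂ : L₂ ∩ R₂ ⊆ avoidEvent arcs s T := by rw [hRT]; intro ω h; exact Or.inr h
  have hR₃₂ : R₃ ⊆ R₂ := fun ω' h' t' ht' => h' t' (Finset.mem_insert_of_mem ht')
  have hsub₃ : L₂ ∩ R₃ ⊆ avoidEvent arcs s T := fun ω h => hsub₂ ⟨h.1, hR₃₂ h.2⟩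
  have hmXY : ∀ ω ∈ avoidEvent arcs s T, X ω * Y ω = X₀ ω * Y₀ ω := fun ω hω => by
    rw [hmX ω hω, hmY ω hω]
  -- the masses
  have mass3 : ∀ (f : Config E → R) (hf : DependsOn f Fᶜ) (g : Config E → R)
      (hg : ∀ ω ∈ avoidEvent arcs s T, g ω = f ω) (Rlast : Set (Config E)) (X' : Finset V)
      (hRl : Rlast = avoidEvent D₀ s X') (hsubl : L₂ ∩ Rlast ⊆ avoidEvent arcs s T)
      (hdl : Disjoint (L₀ ∩ R₀ ∪ L₁ ∩ R₁) (L₂ ∩ Rlast)),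
      massE p g ((L₀ ∩ R₀ ∪ L₁ ∩ R₁) ∪ L₂ ∩ Rlast) =
        prob p L₀ * massE p f R₀ + prob p L₁ * massE p f R₁ + prob p L₂ * massE p f Rlast := by
    intro f hf g hg Rlast X' hRl hsubl hdl
    rw [massE_union_of_disjoint p g hdl, massE_union_of_disjoint p g hd₀₁,
      massE_congr' p (fun ω hω => hg ω (hsub₀ hω)), massE_congr' p (fun ω hω => hg ω (hsub₁ hω)),
      massE_congr' p (fun ω hω => hg ω (hsubl hω)), hRl,
      hfac L₀ hL₀F T f hf, hfac L₁ hL₁F (insert v T) f hf, hfac L₂ hL₂F X' f hf]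
  have eP : prob p (avoidEvent arcs s T) =
      prob p L₀ * prob p R₀ + prob p L₁ * prob p R₁ + prob p L₂ * prob p R₂ := by
    rw [hRT, prob_eq_massE_one, mass3 (fun _ => 1) hdep1 (fun _ => 1) (fun _ _ => rfl) R₂ _ hR₂
      hsub₂ hd₂, ← prob_eq_massE_one, ← prob_eq_massE_one, ← prob_eq_massE_one]
  have eA : massE p X (avoidEvent arcs s T) =
      prob p L₀ * massE p X₀ R₀ + prob p L₁ * massE p X₀ R₁ + prob p L₂ * massE p X₀ R₂ := by
    rw [hRT, mass3 X₀ hdepX X hmX R₂ _ hR₂ hsub₂ hd₂]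
  have eB : massE p Y (avoidEvent arcs s T) =
      prob p L₀ * massE p Y₀ R₀ + prob p L₁ * massE p Y₀ R₁ + prob p L₂ * massE p Y₀ R₂ := by
    rw [hRT, mass3 Y₀ hdepY Y hmY R₂ _ hR₂ hsub₂ hd₂]
  have ePG : prob p (gateEvent arcs s T u w) =
      prob p L₀ * prob p R₀ + prob p L₁ * prob p R₁ + prob p L₂ * prob p R₃ := by
    rw [hGate, prob_eq_massE_one, mass3 (fun _ => 1) hdep1 (fun _ => 1) (fun _ _ => rfl) R₃ _ hR₃
      hsub₃ hd₃, ← prob_eq_massE_one, ← prob_eq_massE_one, ← prob_eq_massE_one]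
  have eAG : massE p X (gateEvent arcs s T u w) =
      prob p L₀ * massE p X₀ R₀ + prob p L₁ * massE p X₀ R₁ + prob p L₂ * massE p X₀ R₃ := by
    rw [hGate, mass3 X₀ hdepX X hmX R₃ _ hR₃ hsub₃ hd₃]
  have eBG : massE p Y (gateEvent arcs s T u w) =
      prob p L₀ * massE p Y₀ R₀ + prob p L₁ * massE p Y₀ R₁ + prob p L₂ * massE p Y₀ R₃ := by
    rw [hGate, mass3 Y₀ hdepY Y hmY R₃ _ hR₃ hsub₃ hd₃]
  have eCG : massE p (fun ω => X ω * Y ω) (gateEvent arcs s T u w) =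
      prob p L₀ * massE p (fun ω => X₀ ω * Y₀ ω) R₀ + prob p L₁ * massE p (fun ω => X₀ ω * Y₀ ω) R₁
        + prob p L₂ * massE p (fun ω => X₀ ω * Y₀ ω) R₃ := by
    rw [hGate, mass3 (fun ω => X₀ ω * Y₀ ω) hdepXY (fun ω => X ω * Y ω) hmXY R₃ _ hR₃ hsub₃ hd₃]
  -- assemble with the three-branch algebra
  unfold DARC phiC
  simp only []
  rw [eP, eA, eB, ePG, eAG, eBG, eCG]
  have hP₃₂ : prob p R₃ ≤ prob p R₂ := prob_mono_of_subset p hp hR₃₂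
  refine path_alg (prob_nonneg hp _) (prob_nonneg hp _) hL₂pos hP₀ hP₁ hP₂ hP₃ hP₃₂ ?_ ?_ ?_
    hA₀₁ hA₁₂ hA₂₃ hB₀₁ hB₁₂ hB₂₃
  · simpa [covC] using hcov₀
  · simpa [covC] using hcov₁
  · simpa [covC] using hcov₃

end PathTheorem

end Summit.Ventures.PercRepro2.Coin
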